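/-
Copyright: the b2b-balaban cell (near-miss cell 7), T⁴-continuum fan-out; row NE7b ROUND-2 swarm, seat
t4-ne7b-formalise-leaf-02 (gen 2; row S4c (iii) «the LE re-plug» of `t4/b2b-balaban-t4-ne7b-p1/LEAVES-NE7b.md`, on the
term-keyed ∕ pedigree road of row S12; typer node A12-I.2 (LE form) of `t4/formal/NE7b/DAG.md`).  Released under the
licence of the surrounding project.
-/
import Summits.QuantumFields.BalabanUV.T4Continuum.Support.HistoryAssemblyTrees
import Summits.QuantumFields.BalabanUV.T4Continuum.Support.HistoryExitLE

/-!
# History assembly over tree slots, LE FORM: the exit WITHOUT the renewal-at-reach clause, every kernel-able binder plugged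

Summits-side support leaf of the T⁴-continuum cell (rung (B)+1 on a FINITE torus only; NOT infinite volume, NOT the
mass gap, NOT the Clay statement; NOT a proof of the spine estimate NE7b).  Row NE7b, route «COUNT», ROUND-2 swarm:
the CONSUMER side of row S4c (owner's ruling R-OWNER-22-6 (iii), «then the display `RenewAtReach` drops»), on the
TERM-KEYED road that the instance of row S12 uses (`HistoryAssemblyTerms` → `HistoryAssemblyPedigree`), journal CLAIM
l.7351.  [folklore] COMPOSITION BY NAME of landed theorems of the cell; nothing is quoted from print, nothing printed is
asserted, no `[cite:]` tag, NO definition, no `Prop`-valued fact is minted (trigger c1); (B), the BetaPertH-flow facts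
and H3 stay DISPLAYED (c4).

WHY.  `HistoryAssemblyTrees.hybridNE7_of_treeBinders_canon` (leaf-03, S12 §3) composes the tree-slot exit
`CountThresholdExit.relWeightBound_lateMergers_of_irThreshold` at `D = 0`, `Δ = 1` with the typed flow along the tuned
runs, the cells, the matching scale, the rates and the two `Regeneration` runs; its labelled-price binder `hlabT` asks,
at every counted slot, for a `ConsistentT` tagged genealogy — and `ConsistentT`'s renewal clause `h + 1 = reach`
(renewal EXACTLY at the booked reach) is the one timing datum the geometric layer cannot supply (owner's F-1(c); leaf-08's
`HistoryRealise.renew_lt_reach` gives `<` only), whence the sub-class display `RenewAtReach` in every END so far.  Row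
S4c re-derived the whole price∕count chain over `HistoryBankingLE.ConsistentTLE` (renewal at `h + 1 ≤ reach`, print's
physical readiness) down to the exit `HistoryExitLE.relWeightBound_canon_of_irThresholdLE` (p208972).  THIS FILE is
leaf-03's §3 junction RE-COMPOSED over that exit: the SAME statement except (i) the labelled-price binder `hlabTLE` asks
for a `ConsistentTLE`, WELL-FORMED (`Gen.WF` over `dictWT`), pending tagged genealogy of the slot's shape, and (ii) the
infrared smallness is read against `HistoryExitLE.irThresholdTLE C F.L rr β₀` — a witness depending on the symbolic
constants ONLY (no shape map, no horizon; owner's R-OWNER-22-11 quantifier order honoured: the threshold is fixed before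
any tag type).  Conclusion, budget, every other binder: byte-identical.

WHAT.  §1 `credits_clampLE`: the credits of a `ConsistentTLE` tagged genealogy read the run's couplings at steps `≤ K`
only (leaf-03's `credits_clamp` under `ConsistentTLE`, via `ConsistentTLE.step_le`).  §2
**`hybridNE7_of_treeBinders_canonLE`**.

WHAT REMAINS DISPLAYED (census, as in `HistoryAssemblyTrees` with two tokens changed).  CONSTANTS: `ThresholdOK`,
`0 < C.μ`, `d·log L + 2·log 2 ≤ κ₁`, `log (2 + birthMass C) ≤ E₀`, `n`, caps `Dcap`∕`Ncap`.  FLOW (⇐ BetaPertH,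
displayed): box β-bounds, `γb ≤ γ₀`, `γb²β′ < 1`, `SmallnessFor`, `pe ≥ p₀, rr`, tuning, `irThresholdTLE C F.L rr β₀ ≤
log g⁻²`, the (2.5) side condition `hR`.  (B): `SignConventions`, `Cor3With`, observable, (α), (γ), sites, envelopes.
H3: the numerator fields per run and the four tree-slot (ID) binders, now with `hlabTLE` (NO `RenewAtReach` upstream of
it: `HistoryGenTimedLE.consistentTLE_genT`∕`wfLE_genT` under `TimedLE`, or leaf-08's `consistentTLE_genT_of_realises`
∕`timedLE_of_realises` from the geometry).  SEAM: `ShellWeightBound`, `ReindexedBudget`, four summable rates.  The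
term-keyed builder over this junction is `Support/HistoryAssemblyTermsLE` (same seat); the class-keyed road is re-plugged
through the socket sibling `Support/HistorySocketTHLE` (leaf-04 gen 2, CLAIM l.7297).

HEADLINE (c4): «COUNT route, tree-slot form WITHOUT the renewal-at-reach clause, reduced to H3 + (B) + BetaPertH-flow +
NE7c socket + NE7 core budget, displayed» — NOT «NE7b proved».  HONEST DEPENDENCY (cell): continuum YM on T⁴ ⇐
BetaPertH ∧ nine spine estimates (0/9 proved); BetaPertH ⇐ (D1) ∧ (D4) ∧ CAP+tail.  This file changes none of it.
-/

open Finset MeasureTheory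
open Literature.MathematicalPhysics.QuantumFieldTheory.Balaban1983to89
open T4PersistenceDictionary T4PersistentHistoryCount T4BankedInduction T4PrintedShapeBanking
open T4WeightBudget T4GlobalDenominator T4LiveClassFibration T4LiveStructureGas T4LiveGasToTerms T4RecordPriceSeam
open T4PartnerMultiplicity T4IndicatorShell T4MatchingAssembly T4MatchingClosure T4MatchingClosureSocket T4Continuum
open T4StabilitySocket T4BranchingRecordsGas T4TaggedShapeBanking T4CanonicalMenus T4RenewalChains
open Summit.QuantumFields.BalabanUV.T4Continuum.PlacementBatch
open Summit.QuantumFields.BalabanUV.T4Continuum.PlacementSkeleton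
open Summit.QuantumFields.BalabanUV.T4Continuum.CountThresholdUniform
open Summit.QuantumFields.BalabanUV.T4Continuum.CountThresholdExit
open Summit.QuantumFields.BalabanUV.T4Continuum.CountSeamJunction
open Summit.QuantumFields.BalabanUV.T4Continuum.LateMergers
open Summit.QuantumFields.BalabanUV.T4Continuum.HistoryFlow
open Summit.QuantumFields.BalabanUV.T4Continuum.HistoryRegeneration
open Summit.QuantumFields.BalabanUV.T4Continuum.HistoryTables
open Summit.QuantumFields.BalabanUV.T4Continuum.HistoryAssemblyTrees
open Summit.QuantumFields.BalabanUV.T4Continuum.HistoryBankingLE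
open Summit.QuantumFields.BalabanUV.T4Continuum.HistoryExitLE

namespace Summit.QuantumFields.BalabanUV.T4Continuum.HistoryAssemblyTreesLE

noncomputable section

/-! ## §1 Clamping a run's couplings at the cutoff, under `ConsistentTLE` -/

section Clamp

variable {ε : Type*} [DecidableEq ε]

/-- the credits of a `ConsistentTLE` tagged genealogy (all events at steps `≤ K`, `ConsistentTLE.step_le`) are those of
the run clamped at the cutoff (= `HistoryAssemblyTrees.credits_clamp` with `ConsistentT ↦ ConsistentTLE`). [folklore] -/
theorem credits_clampLE (sh : ε → PEv) (C : T4PrintedShapeBanking.Consts) (g : ℕ → ℝ) {K : ℕ} {R : ℕ → ℕ}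
    {G : Gen ε} (hc : ConsistentTLE sh C K R G) :
    credits (credit C (fun s => g (min s K)) ∘ sh) G = credits (credit C g ∘ sh) G := by
  unfold credits
  refine Finset.sum_congr rfl fun e he => ?_
  exact credit_clamp C g (hc.step_le e he)

end Clamp

/-! ## §2 The tree-slot exit WITHOUT the renewal-at-reach clause along the tuned runs, everything kernel-able plugged -/

section ExitLevel

variable {F : T4Family} {G : Type*} [GaugeGroup G] [MeasurableSpace G] [HaarData G] [RegularGaugeGroup G]
variable {ε : Type*} [DecidableEq ε]
variable {ι κc : Type*} [DecidableEq κc] [DecidableEq ι] {l₀ vol : ℝ} {K₀ : ℕ} {π : ℕ → ι → κc}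
  {T : ℕ → Finset ι} {A A' shA shB : ℕ → ℝ → ι → ℝ} {Bad' : ℕ → ℝ → Finset κc} {dead dead' : ℕ → ℝ → ι → ℝ}
  {Fc Rf Fc' Rf' : ℕ → κc → ℝ} {nup mup : ℕ → ℝ → ℝ} {Nup : ℝ}
  {Cc Rr CcRec RrRec : ℕ → ℝ → ι → ℝ} {ν u s₂ q₀ r s Wsh : ℕ → ℝ}

/-- **NE7b's COUNT EXIT OVER TREE SLOTS, NO RENEWAL-AT-REACH CLAUSE, ALL KERNEL-ABLE BINDERS PLUGGED.**
`HistoryExitLE.relWeightBound_canon_of_irThresholdLE` (`Δ = 1`; the labelling binder over `ConsistentTLE ∧ Gen.WF ∧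
K < reach`) along the TUNED runs `D.C ⟨K, F.m, g₀ K⟩`, with the typed flow (`HistoryFlow.flowBinders_of_tuned`, run
clamped at the cutoff for the profile binder), cells `cellN d n F.L`, matching scale `jhalf`, rates at `η̄₊ = log 2`
(`treeRates_of_large`) and the two `Regeneration` runs (`HistoryRegeneration.regeneration_pair_of_cor3With`) plugged,
then `CountSeamJunction.hybridNE7_of_eventually`.  = `HistoryAssemblyTrees.hybridNE7_of_treeBinders_canon` with
`hlabT ↦ hlabTLE` and `hir` over `irThresholdTLE C F.L rr β₀` (constants only); conclusion byte-identical.  Displayed: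
constants (+ two largeness conditions), flow, tuning, `irThresholdTLE … ≤ log g⁻²`, (2.5) side condition, (B) side, H3
numerator readings, the four TREE-SLOT (ID) binders, the seam data. [folklore] -/
theorem hybridNE7_of_treeBinders_canonLE (D : FiniteEpsData F G) (sh : ε → PEv) {C : T4PrintedShapeBanking.Consts}
    {rr : ℕ} {β₀ : ℝ} (h : ThresholdOK C F.L rr β₀) (hμ : 0 < C.μ) (d n : ℕ) (Dcap Ncap : ℕ → ℕ)
    -- two largeness conditions on the free bank constants
    (hκ₁ : (d : ℝ) * Real.log F.L + 2 * Real.log 2 ≤ C.κ₁) (hE₀ : Real.log (2 + birthMass C) ≤ C.E₀)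
    -- the flow side (⇐ BetaPertH, displayed) and tuning
    {γ₀ γb b β' : ℝ} {pe : ℕ} (hb : 0 ≤ b) (hlo : FlowStep.BetaLowerH b γ₀ D.βfun)
    (hhi : FlowStep.BetaUpperH β' γ₀ D.βfun) (hγ : γb ≤ γ₀) (hγβ : γb ^ 2 * β' < 1)
    (S : B14FlowStep.SmallnessFor γb β' β₀ F.L pe) (hp₀ : C.p₀ ≤ pe) (hrr : rr ≤ pe)
    {g : ℝ} {g₀ : ℕ → ℝ} (ht : D.Tuned γb g g₀)
    (hir : irThresholdTLE C F.L rr β₀ ≤ Real.log (g ^ 2)⁻¹)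
    -- the (B) side
    (hsign : B16.SignConventions D.C) {γB : ℝ} {em ep : ℝ → ℝ} (hcor : B16.Cor3With D.C γB em ep) (hγB : γb ≤ γB)
    {obs : (K : ℕ) → GaugeField (F.P K) 0 G → ℝ} {B : ℝ}
    (hobs : ∀ K, Measurable (obs K)) (hbd : ∀ K U, |obs K U| ≤ B)
    (hα : ∀ K t, |t| ≤ l₀ → K₀ ≤ K →
      ∫ U, Real.exp (t * obs K U) * D.dens K (g₀ K) 0 U ∂fieldMeasure (F.P K) 0 G ≤ ∑ τ ∈ T K, A K t τ)
    (hα' : ∀ K t, |t| ≤ l₀ → K₀ ≤ K →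
      ∫ U, Real.exp (t * obs (K + 1) U) * D.dens (K + 1) (g₀ (K + 1)) 0 U ∂fieldMeasure (F.P (K + 1)) 0 G ≤
        ∑ τ ∈ T K, A' K t τ)
    {c₀ n₁ : ℝ} (hc₀ : 0 < c₀) (hfloor : ∀ K, K₀ ≤ K → c₀ ≤ smallFieldMass D K (g₀ K))
    (hfloor' : ∀ K, K₀ ≤ K → c₀ ≤ smallFieldMass D (K + 1) (g₀ (K + 1)))
    (hsites : ∀ K, K₀ ≤ K → ((D.C ⟨K, F.m, g₀ K⟩).numSites K : ℝ) ≤ n₁)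
    (hsites' : ∀ K, K₀ ≤ K → ((D.C ⟨K + 1, F.m, g₀ (K + 1)⟩).numSites (K + 1) : ℝ) ≤ n₁)
    (hNup : 0 ≤ Nup) (hnup : ∀ K t, |t| ≤ l₀ → K₀ ≤ K → 0 ≤ nup K t ∧ nup K t ≤ Nup)
    (hmup : ∀ K t, |t| ≤ l₀ → K₀ ≤ K → 0 ≤ mup K t ∧ mup K t ≤ Nup)
    -- H3: the displayed numerator reading of both runs over the ABSTRACT term family
    (bad_subset : ∀ K t, |t| ≤ l₀ → K₀ ≤ K → Bad' K t ⊆ classIndex π T K)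
    (up : ∀ K t, |t| ≤ l₀ → K₀ ≤ K → ∀ c ∈ Bad' K t, ∀ τ ∈ fibre π T K c, A K t τ ≤ dead K t τ * Fc K c * nup K t)
    (dead_nonneg : ∀ K t, |t| ≤ l₀ → K₀ ≤ K → ∀ c ∈ Bad' K t, ∀ τ ∈ fibre π T K c, 0 ≤ dead K t τ)
    (resum : ∀ K t, |t| ≤ l₀ → K₀ ≤ K → ∀ c ∈ Bad' K t, ∑ τ ∈ fibre π T K c, dead K t τ ≤ Rf K c)
    (F_nonneg : ∀ K t, |t| ≤ l₀ → K₀ ≤ K → ∀ c ∈ Bad' K t, 0 ≤ Fc K c)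
    (up' : ∀ K t, |t| ≤ l₀ → K₀ ≤ K → ∀ c ∈ Bad' K t, ∀ τ ∈ fibre π T K c,
      A' K t τ ≤ dead' K t τ * Fc' K c * mup K t)
    (dead'_nonneg : ∀ K t, |t| ≤ l₀ → K₀ ≤ K → ∀ c ∈ Bad' K t, ∀ τ ∈ fibre π T K c, 0 ≤ dead' K t τ)
    (resum' : ∀ K t, |t| ≤ l₀ → K₀ ≤ K → ∀ c ∈ Bad' K t, ∑ τ ∈ fibre π T K c, dead' K t τ ≤ Rf' K c)
    (F'_nonneg : ∀ K t, |t| ≤ l₀ → K₀ ≤ K → ∀ c ∈ Bad' K t, 0 ≤ Fc' K c)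
    -- the (2.5) side condition on the size function the (ID) data are built over
    (R : ℕ → ℕ → ℕ) (hR : ∀ K s, s ≤ K → B14.IsRj F.L rr ((D.C ⟨K, F.m, g₀ K⟩).flow.g s) (R K s))
    -- the four TREE-SLOT (ID) binders over the canonical cells and the canonical run family, LE form
    (y : ℕ → ℕ → (Fin d → ℕ) → Gen PEv → ℝ)
    (hy0 : ∀ K, ∀ j ≤ K, ∀ z ∈ cellN d n F.L K (K - j), ∀ Gs ∈ canonFam Dcap Ncap K j, 0 ≤ y K j z Gs)
    (hlabTLE : ∀ K, K₀ ≤ K → ∀ j ≤ K, ∀ z ∈ cellN d n F.L K (K - j), ∀ Gs ∈ canonFam Dcap Ncap K j,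
      y K j z Gs ≤ 0 ∨ ∃ G' : Gen ε, ConsistentTLE sh C K (R K) G' ∧ G'.WF (dictWT sh (R K) C.n₁) ∧
        K < G'.reach (dictWT sh (R K) C.n₁) ∧ relabel (shape ∘ sh) G' = Gs ∧
        y K j z Gs ≤ ((F.L : ℝ) ^ d) ^ partnerAges (PEv.step ∘ sh) G' *
          (Real.exp (-credits (credit C (D.C ⟨K, F.m, g₀ K⟩).flow.g ∘ sh) G') *
            Real.exp (lifeCost (dictWT sh (R K) C.n₁) (costT sh C K (R K)) G')))
    (str : ℕ → κc → Finset (BSlot (Fin d → ℕ) PEv))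
    (hinj : ∀ K t, |t| ≤ l₀ → K₀ ≤ K → Set.InjOn (str K) (Bad' K t))
    (hstr : ∀ K t, |t| ≤ l₀ → K₀ ≤ K → ∀ cl ∈ Bad' K t,
      str K cl ⊆ bliveSlots (cellN d n F.L) (canonFam Dcap Ncap) K ∧
        ∃ o ∈ boldSlots (cellN d n F.L) (canonFam Dcap Ncap) jhalf K, o ∈ str K cl)
    (hF : ∀ K t, |t| ≤ l₀ → K₀ ≤ K → ∀ cl ∈ Bad' K t, Fc K cl * Rf K cl ≤ famWeight (bslotPrice (y K)) (str K cl))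
    (hF' : ∀ K t, |t| ≤ l₀ → K₀ ≤ K → ∀ cl ∈ Bad' K t,
      Fc' K cl * Rf' K cl ≤ famWeight (bslotPrice (y K)) (str K cl))
    -- the seam's other inputs (NE7c socket, NE7 core budget, four summable rates)
    (hSh : ShellWeightBound l₀ T A A' shA shB Wsh)
    (hTB : ReindexedBudget l₀ vol T (fun K t τ => A K t τ - shA K t τ) (fun K t τ => A' K t τ - shB K t τ)
      (badOfClass π T Bad') Cc Rr CcRec RrRec ν u s₂ q₀ r s)
    (hr : Summable r) (hu : Summable u) (hs : Summable s) (hs₂ : Summable s₂) :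
    ∃ K₁ K₂, K₀ ≤ K₁ ∧ HybridNE7 l₀ vol (fun K => T (K₁ + (K₂ + K))) (fun K => A (K₁ + (K₂ + K)))
      (fun K => A' (K₁ + (K₂ + K))) (fun K => badOfClass π T Bad' (K₁ + (K₂ + K)))
      (fun K => constOf l₀ B (max (em g) 0) n₁ c₀ Nup *
        recordsBudget (birthMass C) C.κ₁ ((n : ℝ) ^ d) ((F.L : ℝ) ^ d) (Real.log 2) jhalf (K₁ + (K₂ + K)))
      (fun K => shA (K₁ + (K₂ + K))) (fun K => shB (K₁ + (K₂ + K))) (fun K => Wsh (K₁ + (K₂ + K)))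
      (fun K => (r (K₁ + (K₂ + K)) + u (K₁ + (K₂ + K))) + (s (K₁ + (K₂ + K)) + s₂ (K₁ + (K₂ + K)))) := by
  -- (i) the typed flow along the tuned runs (S8), clamped at the cutoff
  obtain ⟨h27, h29, hx1, -⟩ := flowBinders_of_tuned D hb hlo hhi hγ hγβ S hp₀ hrr ht R hR
  set gr : ℕ → ℕ → ℝ := fun K s => (D.C ⟨K, F.m, g₀ K⟩).flow.g (min s K) with hgr
  have h27' : ∀ K, K₀ ≤ K → B14.FlowIneq27 (gr K) β' β₀ C.p₀ K := fun K _ => flowIneq27_clamp (h27 K)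
  have h29' : ∀ K, K₀ ≤ K → B14FlowStep.FlowIneq29 (R K) (gr K) F.L β' β₀ K := fun K _ => flowIneq29_clamp (h29 K)
  have hR' : ∀ K, K₀ ≤ K → ∀ s, s ≤ K → B14.IsRj F.L rr (gr K s) (R K s) := by
    intro K _ s hs
    show B14.IsRj F.L rr ((D.C ⟨K, F.m, g₀ K⟩).flow.g (min s K)) (R K s)
    rw [min_eq_left hs]; exact hR K s hs
  have hx1' : ∀ K, K₀ ≤ K → ∀ s, s ≤ K → 1 ≤ Real.log ((gr K s) ^ 2)⁻¹ := by
    intro K _ s hs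
    show 1 ≤ Real.log (((D.C ⟨K, F.m, g₀ K⟩).flow.g (min s K)) ^ 2)⁻¹
    rw [min_eq_left hs]; exact hx1 K s hs
  have hir' : ∀ K, K₀ ≤ K → irThresholdTLE C F.L rr β₀ ≤ Real.log ((gr K K) ^ 2)⁻¹ := by
    intro K _
    show _ ≤ Real.log (((D.C ⟨K, F.m, g₀ K⟩).flow.g (min K K)) ^ 2)⁻¹
    rw [min_self, (ht K).2]; exact hir
  have hP : ∀ K s, 0 ≤ p0Profile C.A₀ C.p₀ (gr K s) := fun K s =>
    p0Profile_nonneg_of_one_le_log C.p₀ h.A₀_pos.le (hx1 K (min s K) (min_le_right s K))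
  -- (iii) the two `Regeneration` runs with ONE constant (S11)
  obtain ⟨hA, hA'⟩ := regeneration_pair_of_cor3With D hsign hcor hγB ht hobs hbd hα hα' hc₀ hfloor hfloor' hsites
    hsites' hnup hmup bad_subset up dead_nonneg resum F_nonneg up' dead'_nonneg resum' F'_nonneg
  have hCn : 0 ≤ constOf l₀ B (max (em g) 0) n₁ c₀ Nup := constOf_nonneg hNup hc₀.le
  -- (ii) cells, matching scale, rates (S12 §1 + §2)
  have hL1 : 1 ≤ F.L := le_trans (by norm_num) (two_le_L F)
  have hLpos : (0 : ℝ) < F.L := by exact_mod_cast (lt_of_lt_of_le (by norm_num) hL1)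
  obtain ⟨hrate, h1, hx⟩ := treeRates_of_large hL1 d (birthMass_nonneg hμ) hκ₁ hE₀
  -- the labelled-price binder in the LE exit's `Δ = 1` form, over the clamped run
  have hlab' : ∀ K, K₀ ≤ K → ∀ j ≤ K, ∀ z ∈ cellN d n F.L K (K - j), ∀ Gs ∈ canonFam Dcap Ncap K j,
      y K j z Gs ≤ 0 ∨ ∃ G' : Gen ε, ConsistentTLE sh C K (R K) G' ∧ G'.WF (dictWT sh (R K) C.n₁) ∧
        K < G'.reach (dictWT sh (R K) C.n₁) ∧ relabel (shape ∘ sh) G' = Gs ∧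
        y K j z Gs ≤ 1 * (((F.L : ℝ) ^ d) ^ partnerAges (PEv.step ∘ sh) G' *
          (Real.exp (-credits (credit C (gr K) ∘ sh) G') *
            Real.exp (lifeCost (dictWT sh (R K) C.n₁) (costT sh C K (R K)) G'))) := by
    intro K hK j hj z hz Gs hGs
    rcases hlabTLE K hK j hj z hz Gs hGs with h0 | ⟨G', hc, hw, hreach, hrel, hy⟩
    · exact Or.inl h0
    · refine Or.inr ⟨G', hc, hw, hreach, hrel, ?_⟩
      rw [one_mul, credits_clampLE sh C _ hc]
      exact hy
  have hmain := relWeightBound_canon_of_irThresholdLE sh h hμ (cellN d n F.L) (V := (n : ℝ) ^ d)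
    (Λ := (F.L : ℝ) ^ d) (by positivity) (pow_pos hLpos d) (card_cellN_le d n hL1) Dcap Ncap jhalf jhalf_le
    (c := 1 / 2) (by norm_num) half_le_sub_jhalf (Δ := 1) le_rfl hA hA' hCn R gr (fun _ => β') h27' h29' hR' hx1'
    hir' hP (Real.log_nonneg one_le_two) hrate (pow_nonneg hLpos.le d) h1 hx y hy0 hlab' str hinj hstr hF hF'
  have e0 : (1 : ℝ) * birthMass C = birthMass C := one_mul _
  rw [e0] at hmain
  exact hybridNE7_of_eventually hmain hSh hTB hr hu hs hs₂

end ExitLevel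

end

end Summit.QuantumFields.BalabanUV.T4Continuum.HistoryAssemblyTreesLE
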